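import Literature.Probability.Percolation.EnhancedClusterModification
import Literature.Probability.Percolation.CoinTranscript
import HarnessLib

/-!
# The exploration of the enhanced cluster (Martineau–Severo 2019, §5): the state machine and its run on `ℋ`

Seventh file of the inline proof of `Literature.Probability.Percolation.MartineauSevero2019_cor22`.
Martineau–Severo (Ann. Probab. 47 (2019), §5, "Structure of the process") explore the enhanced cluster
`𝒞_o(ω, α)` of `ℋ` algorithmically: Step `2K+1` `p`-explores, one at a time, the unexplored edges of `ℋ`
meeting the current cluster (reading the `M` parallel copies of the edge); Step `2K+2` `s`-explores the
vertices `u` of the cluster whose ball `B_r(u)` is fully open (reading the mark `α_u`), adding `S_{r+1}(u)` on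
success; "no vertex or edge will get explored more than once". The same sequence of queries is answered on
`𝒢` by reading lifted coins (the sequel file); the present file is the `ℋ`-level machine, common to both
sides, and its run on `ℋ`:

* `EQuery`, `EState`, `enq` (next query: an unexplored window edge at the explored set first, else an
  un-attempted explored vertex of `B_L(o)` whose `r`-ball is explored-open), `estep`, `estateOf` (replay of a
  transcript) — a deterministic function of the Boolean transcript, as in `CoinTranscript.lean`.
* The `ℋ`-side coins `HCoin W M T = (Sym2 W × Fin M) ⊕ (W × Fin T)` (the `M` copies of each edge, and `T`
  coins per vertex realising the mark: `ω_e = ∨_k`, `α_u = ∧_j`, so that under `Ber(q)^⊗` one has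
  `ℙ(ω_e) = 1-(1-q)^M =: p`, `ℙ(α_u) = q^T =: s`), the decoding `hOmega`, `hAlpha`, and the strategy
  `hStrategy` (edge query ↦ its `M` copies, kind "some open"; bonus ↦ the `T` mark coins, kind "all open").
* `hStrategy_freshAlong` (each edge / vertex is queried once), the halting bound `enq_estateOf_run_eq_none`
  (after `N₀ = |E-window| + |V-window| + 1` steps), and **correctness** `setOf_reaches_run_eq`: for
  `N ≥ N₀`, the transcript event "an explored vertex at distance `≥ L`" is the event `𝓔_L` of the decoded
  configuration (Martineau–Severo: "By construction, `C_∞` has the distribution of the cluster of the origin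
  for the `(p,s)`-process on `ℋ`: it is the cluster of the origin of `((∨_k ω_{e,k})_e, α)`").

## References

* S. Martineau, F. Severo, Ann. Probab. 47 (2019), §5 (Structure of the process; Steps `2K+1`, `2K+2`,
  Step ∞) [MartineauSevero2019].
-/

noncomputable section

namespace Literature.Probability.Percolation

open Literature.Barriers.CriticalPhenomena
open scoped Classical

variable {W : Type*}

/-! ### Spheres -/

/-- The sphere `S_n(u) = {v : dist(u,v) = n}` of a locally finite graph, as a `Finset`.
[cite: MartineauSevero2019, §4 (Notation: S_r(x))] -/
def sphereFin (H : SimpleGraph W) [H.LocallyFinite] (u : W) (n : ℕ) : Finset W :=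
  (ballFin H u n).filter fun v => H.dist u v = n

/-- Membership in the sphere (connected graph). [folklore] -/
theorem mem_sphereFin_iff {H : SimpleGraph W} [H.LocallyFinite] (hH : H.Connected) {u v : W} {n : ℕ} :
    v ∈ sphereFin H u n ↔ H.dist u v = n := by
  rw [sphereFin, Finset.mem_filter, mem_ballFin]
  exact ⟨fun h => h.2, fun h => ⟨mem_graphBall_of_dist_le hH h.le, h⟩⟩

/-! ### The state machine -/

/-- A query of the exploration: the `ℋ`-edge `s(u,v)` probed from its explored endpoint `u`
("`p`-exploration", Step `2K+1`), or the bonus of the explored vertex `u` ("`s`-exploration", Step `2K+2`).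
[cite: MartineauSevero2019, §5 (Steps 2K+1, 2K+2)] -/
inductive EQuery (W : Type*)
  | edge (u v : W) : EQuery W
  | bonus (u : W) : EQuery W

/-- The state of the exploration: explored vertices `A` (the part of `𝒞_o(ω,α)` found so far, M–S's
`C_{ℓ,n}`), queried edges `Q`, queried edges found open `O`, vertices `Y` whose bonus was attempted.
[cite: MartineauSevero2019, §5 (C_{ℓ,n}; p-explored edges; s-explored vertices)] -/
structure EState (W : Type*) where
  /-- explored vertices -/
  A : Finset W
  /-- queried `ℋ`-edges -/
  Q : Finset (Sym2 W)
  /-- queried `ℋ`-edges found open -/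
  O : Finset (Sym2 W)
  /-- vertices whose bonus has been attempted -/
  Y : Finset W

namespace EState

/-- The initial state: only the origin is explored (Step 0: `C_0 = {o}`). [cite: MartineauSevero2019, §5 (Step 0)] -/
def init (o : W) : EState W := ⟨{o}, ∅, ∅, ∅⟩

end EState

section Machine

variable (H : SimpleGraph W) [H.LocallyFinite] (r : ℕ) (o : W) (L : ℕ)

/-- The edge window of the exploration at level `L`: the edges of `B_{L+r+1}(o)`.
[cite: MartineauSevero2019, §6 (𝓔_L depends on finitely many coordinates)] -/
def edgeWindow : Finset (Sym2 W) := edgesInBallFin H o (L + r + 1)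

/-- The vertex window: bonuses are attempted at vertices of `B_L(o)` only. [cite: MartineauSevero2019, §6] -/
def vertWindow : Finset W := ballFin H o L

/-- An **available edge query** in state `σ`: an unqueried window edge `s(u,v)` of `ℋ` at an explored `u`.
[cite: MartineauSevero2019, §5 (Step 2K+1: "an unexplored edge that intersects C")] -/
def EdgeAvail (σ : EState W) (p : W × W) : Prop :=
  p.1 ∈ σ.A ∧ H.Adj p.1 p.2 ∧ s(p.1, p.2) ∈ edgeWindow H r o L ∧ s(p.1, p.2) ∉ σ.Q

/-- An **available bonus** in state `σ`: an explored, un-attempted vertex of the vertex window whose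
`r`-ball is explored-open. [cite: MartineauSevero2019, §5 (Step 2K+2: "an s-unexplored vertex in C whose r-ball is fully open")] -/
def BonusAvail (σ : EState W) (u : W) : Prop :=
  u ∈ σ.A ∧ u ∈ vertWindow H o L ∧ u ∉ σ.Y ∧ edgesInBallFin H u r ⊆ σ.O

/-- **The next query** (`none` = halt): an available edge query if there is one (`p`-exploration first, so
that a bonus is attempted only after a complete round of `p`-exploration), else an available bonus.
[cite: MartineauSevero2019, §5 (Steps 2K+1, 2K+2)] -/
def enq (σ : EState W) : Option (EQuery W) :=
  if h : ∃ p : W × W, EdgeAvail H r o L σ p then some (EQuery.edge h.choose.1 h.choose.2)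
  else if h' : ∃ u : W, BonusAvail H r o L σ u then some (EQuery.bonus h'.choose)
  else none

/-- **One step**: record the query and, on a positive answer, add the far endpoint (edge query) or the
sphere `S_{r+1}(u)` (bonus). [cite: MartineauSevero2019, §5 (C_{2K+1,n+1} := C ∪ {v}; C_{2K+2,n+1} := C ∪ S_{r+1}(u))] -/
def estep (σ : EState W) : EQuery W → Bool → EState W
  | EQuery.edge u v, a =>
    { A := if a then insert v σ.A else σ.A
      Q := insert s(u, v) σ.Q
      O := if a then insert s(u, v) σ.O else σ.O
      Y := σ.Y }
  | EQuery.bonus u, a =>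
    { A := if a then σ.A ∪ sphereFin H u (r + 1) else σ.A
      Q := σ.Q
      O := σ.O
      Y := insert u σ.Y }

/-- **The state after a transcript** (answers newest first): replay the machine.
[cite: MartineauSevero2019, §5] -/
def estateOf : List Bool → EState W
  | [] => EState.init o
  | a :: b => match enq H r o L (estateOf b) with
    | none => estateOf b
    | some q => estep H r (estateOf b) q a

variable {H r o L}

/-- What an edge query guarantees. [cite: MartineauSevero2019, §5 (Step 2K+1)] -/
theorem enq_edge_spec {σ : EState W} {u v : W} (h : enq H r o L σ = some (EQuery.edge u v)) :
    EdgeAvail H r o L σ (u, v) := by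
  unfold enq at h
  split_ifs at h with h1 h2
  · simp only [Option.some.injEq, EQuery.edge.injEq] at h
    obtain ⟨rfl, rfl⟩ := h
    exact h1.choose_spec
  · simp at h

/-- What a bonus query guarantees: no edge query was available, and the bonus is available.
[cite: MartineauSevero2019, §5 (Step 2K+2)] -/
theorem enq_bonus_spec {σ : EState W} {u : W} (h : enq H r o L σ = some (EQuery.bonus u)) :
    (¬ ∃ p : W × W, EdgeAvail H r o L σ p) ∧ BonusAvail H r o L σ u := by
  unfold enq at h
  split_ifs at h with h1 h2
  · simp at h
  · simp only [Option.some.injEq, EQuery.bonus.injEq] at h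
    subst h
    exact ⟨h1, h2.choose_spec⟩

/-- The machine halts iff no query is available. [folklore] -/
theorem enq_eq_none_iff {σ : EState W} :
    enq H r o L σ = none ↔ (¬ ∃ p : W × W, EdgeAvail H r o L σ p) ∧ ¬ ∃ u : W, BonusAvail H r o L σ u := by
  unfold enq
  split_ifs with h1 h2
  · simp only [false_iff, not_and, not_not]
    exact fun h => absurd h1 h
  · simp only [false_iff, not_and, not_not]
    exact fun _ => h2
  · simp [h1, h2]

/-- Replay of a cons. [folklore] -/
theorem estateOf_cons (a : Bool) (b : List Bool) :
    estateOf H r o L (a :: b) = match enq H r o L (estateOf H r o L b) with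
      | none => estateOf H r o L b
      | some q => estep H r (estateOf H r o L b) q a := rfl

/-! ### Membership in the updated state -/

/-- Explored set after an edge query. [folklore] -/
theorem mem_estep_edge_A {σ : EState W} {u v w : W} {a : Bool} :
    w ∈ (estep H r σ (EQuery.edge u v) a).A ↔ (a = true ∧ w = v) ∨ w ∈ σ.A := by
  cases a <;> simp [estep]

/-- Queried edges after an edge query. [folklore] -/
theorem mem_estep_edge_Q {σ : EState W} {u v : W} {e : Sym2 W} {a : Bool} :
    e ∈ (estep H r σ (EQuery.edge u v) a).Q ↔ e = s(u, v) ∨ e ∈ σ.Q := by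
  simp [estep]

/-- Recorded-open edges after an edge query. [folklore] -/
theorem mem_estep_edge_O {σ : EState W} {u v : W} {e : Sym2 W} {a : Bool} :
    e ∈ (estep H r σ (EQuery.edge u v) a).O ↔ (a = true ∧ e = s(u, v)) ∨ e ∈ σ.O := by
  cases a <;> simp [estep]

/-- Attempted vertices are unchanged by an edge query. [folklore] -/
@[simp] theorem estep_edge_Y (σ : EState W) (u v : W) (a : Bool) : (estep H r σ (EQuery.edge u v) a).Y = σ.Y := rfl

/-- Explored set after a bonus. [folklore] -/
theorem mem_estep_bonus_A {σ : EState W} {u w : W} {a : Bool} :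
    w ∈ (estep H r σ (EQuery.bonus u) a).A ↔ w ∈ σ.A ∨ (a = true ∧ w ∈ sphereFin H u (r + 1)) := by
  cases a <;> simp [estep]

/-- Queried edges are unchanged by a bonus. [folklore] -/
@[simp] theorem estep_bonus_Q (σ : EState W) (u : W) (a : Bool) : (estep H r σ (EQuery.bonus u) a).Q = σ.Q := rfl

/-- Recorded-open edges are unchanged by a bonus. [folklore] -/
@[simp] theorem estep_bonus_O (σ : EState W) (u : W) (a : Bool) : (estep H r σ (EQuery.bonus u) a).O = σ.O := rfl

/-- Attempted vertices after a bonus. [folklore] -/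
theorem mem_estep_bonus_Y {σ : EState W} {u w : W} {a : Bool} :
    w ∈ (estep H r σ (EQuery.bonus u) a).Y ↔ w = u ∨ w ∈ σ.Y := by
  simp [estep]

/-! ### Monotonicity and the bookkeeping invariants of the replay -/

/-- One step only grows `A`, `Q`, `O`, `Y`. [cite: MartineauSevero2019, §5 ("The sequence of sets (C_n) is non-decreasing")] -/
theorem estep_mono (σ : EState W) (q : EQuery W) (a : Bool) :
    σ.A ⊆ (estep H r σ q a).A ∧ σ.Q ⊆ (estep H r σ q a).Q ∧ σ.O ⊆ (estep H r σ q a).O ∧ σ.Y ⊆ (estep H r σ q a).Y := by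
  cases q with
  | edge u v =>
    cases a <;> simp [estep, Finset.subset_insert]
  | bonus u =>
    cases a <;> simp [estep, Finset.subset_insert, Finset.subset_union_left]

/-- The replay only grows along a transcript. [folklore] -/
theorem estateOf_mono (a : Bool) (b : List Bool) :
    (estateOf H r o L b).A ⊆ (estateOf H r o L (a :: b)).A ∧ (estateOf H r o L b).Q ⊆ (estateOf H r o L (a :: b)).Q ∧
      (estateOf H r o L b).O ⊆ (estateOf H r o L (a :: b)).O ∧ (estateOf H r o L b).Y ⊆ (estateOf H r o L (a :: b)).Y := by
  rw [estateOf_cons]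
  cases enq H r o L (estateOf H r o L b) with
  | none => exact ⟨subset_rfl, subset_rfl, subset_rfl, subset_rfl⟩
  | some q => exact estep_mono (estateOf H r o L b) q a

/-- The origin is always explored. [cite: MartineauSevero2019, §5 (Step 0)] -/
theorem origin_mem_estateOf (b : List Bool) : o ∈ (estateOf H r o L b).A := by
  induction b with
  | nil => simp [estateOf, EState.init]
  | cons a b ih => exact (estateOf_mono a b).1 ih

/-- **Window invariants**: queried edges lie in the edge window, open queried edges are queried, attempted
vertices lie in the vertex window. [cite: MartineauSevero2019, §5] -/
theorem estateOf_window (b : List Bool) :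
    (estateOf H r o L b).Q ⊆ edgeWindow H r o L ∧ (estateOf H r o L b).O ⊆ (estateOf H r o L b).Q ∧
      (estateOf H r o L b).Y ⊆ vertWindow H o L := by
  induction b with
  | nil => simp [estateOf, EState.init]
  | cons a b ih =>
    obtain ⟨h1, h2, h3⟩ := ih
    rw [estateOf_cons]
    cases hq : enq H r o L (estateOf H r o L b) with
    | none => exact ⟨h1, h2, h3⟩
    | some q =>
      cases q with
      | edge u v =>
        have hsp := enq_edge_spec hq
        refine ⟨?_, ?_, ?_⟩
        · simp only [estep]
          exact Finset.insert_subset hsp.2.2.1 h1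
        · cases a <;> simp only [estep, if_true, Bool.false_eq_true, if_false]
          · exact h2.trans (Finset.subset_insert _ _)
          · exact Finset.insert_subset_insert _ h2
        · simpa [estep] using h3
      | bonus u =>
        have hsp := (enq_bonus_spec hq).2
        refine ⟨by simpa [estep] using h1, by simpa [estep] using h2, ?_⟩
        simp only [estep]
        exact Finset.insert_subset hsp.2.1 h3

/-! ### The `ℋ`-side coins and strategy -/

/-- The `ℋ`-side coins: `M` copies of each pair of vertices (only edges are used) and `T` mark coins per
vertex. [cite: MartineauSevero2019, §5 (the multigraph Ĥ; the marks α)] -/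
abbrev HCoin (W : Type*) (M T : ℕ) : Type _ := (Sym2 W × Fin M) ⊕ (W × Fin T)

/-- The decoded open edges: `ω_e = ∨_k ω_{(e,k)}`. [cite: MartineauSevero2019, §5 ("(∨_k ω_{e,k})_e")] -/
def hOmega {M T : ℕ} (c : Set (HCoin W M T)) : Set (Sym2 W) := {e | ∃ k : Fin M, (Sum.inl (e, k) : HCoin W M T) ∈ c}

/-- The decoded marks: `α_u = ∧_j α_{(u,j)}` (so that `ℙ(α_u) = q^T`). [cite: MartineauSevero2019, §5 (α with distribution Ber(s)^{⊗V(ℋ)})] -/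
def hAlpha {M T : ℕ} (c : Set (HCoin W M T)) : Set W := {u | ∀ j : Fin T, (Sum.inr (u, j) : HCoin W M T) ∈ c}

/-- The `M` copies of an edge, as coins. [cite: MartineauSevero2019, §5 (E(ℋ) × {1,…,M})] -/
def edgeCoins (M T : ℕ) (e : Sym2 W) : Finset (HCoin W M T) :=
  (Finset.univ : Finset (Fin M)).map ⟨fun k => Sum.inl (e, k), fun k k' h => by simpa using h⟩

/-- The `T` mark coins of a vertex. [cite: MartineauSevero2019, §5 (α_u)] -/
def markCoins (M T : ℕ) (u : W) : Finset (HCoin W M T) :=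
  (Finset.univ : Finset (Fin T)).map ⟨fun j => Sum.inr (u, j), fun j j' h => by simpa using h⟩

/-- Membership in `edgeCoins`. [folklore] -/
@[simp] theorem mem_edgeCoins {M T : ℕ} {e : Sym2 W} {i : HCoin W M T} :
    i ∈ edgeCoins M T e ↔ ∃ k : Fin M, i = Sum.inl (e, k) := by
  simp [edgeCoins, eq_comm]

/-- Membership in `markCoins`. [folklore] -/
@[simp] theorem mem_markCoins {M T : ℕ} {u : W} {i : HCoin W M T} :
    i ∈ markCoins M T u ↔ ∃ j : Fin T, i = Sum.inr (u, j) := by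
  simp [markCoins, eq_comm]

/-- `|edgeCoins| = M`. [folklore] -/
@[simp] theorem card_edgeCoins (M T : ℕ) (e : Sym2 W) : (edgeCoins M T e : Finset (HCoin W M T)).card = M := by
  simp [edgeCoins]

/-- `|markCoins| = T`. [folklore] -/
@[simp] theorem card_markCoins (M T : ℕ) (u : W) : (markCoins M T u : Finset (HCoin W M T)).card = T := by
  simp [markCoins]

/-- The `ℋ`-side encoding of a query: an edge query reads the `M` copies of the edge ("some open"), a bonus
reads the `T` mark coins ("all open"). [cite: MartineauSevero2019, §5 (Steps 2K+1, 2K+2 on ℋ)] -/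
def hEncode (M T : ℕ) : EQuery W → CoinQuery (HCoin W M T)
  | EQuery.edge u v => ⟨edgeCoins M T s(u, v), false⟩
  | EQuery.bonus u => ⟨markCoins M T u, true⟩

variable (H r o L)

/-- **The `ℋ`-side strategy**: replay the machine on the transcript and encode its next query.
[cite: MartineauSevero2019, §5 (the (p,s)-process on ℋ)] -/
def hStrategy (M T : ℕ) : CoinStrategy (HCoin W M T) :=
  ⟨fun b => (enq H r o L (estateOf H r o L b)).map (hEncode M T)⟩

variable {H r o L}

/-- The next query of the `ℋ`-side strategy. [folklore] -/
theorem hStrategy_next (M T : ℕ) (b : List Bool) :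
    (hStrategy H r o L M T).next b = (enq H r o L (estateOf H r o L b)).map (hEncode M T) := rfl

/-- The answer to an encoded edge query is "the edge is open in the decoded configuration". [cite: MartineauSevero2019, §5] -/
theorem answer_hEncode_edge {M T : ℕ} (u v : W) (c : Set (HCoin W M T)) :
    (hEncode M T (EQuery.edge u v)).answer c = decide (s(u, v) ∈ hOmega c) := by
  simp [hEncode, CoinQuery.answer, hOmega]

/-- The answer to an encoded bonus is "the vertex is marked in the decoded configuration". [cite: MartineauSevero2019, §5] -/
theorem answer_hEncode_bonus {M T : ℕ} (u : W) (c : Set (HCoin W M T)) :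
    (hEncode M T (EQuery.bonus u)).answer c = decide (u ∈ hAlpha c) := by
  simp [hEncode, CoinQuery.answer, hAlpha]

/-- **The coins used along a transcript** are copies of queried edges or mark coins of attempted vertices.
[cite: MartineauSevero2019, §5 ("No vertex or edge will get explored more than once")] -/
theorem used_hStrategy_subset {M T : ℕ} (b : List Bool) :
    ∀ i ∈ (hStrategy H r o L M T).used b,
      (∃ e ∈ (estateOf H r o L b).Q, ∃ k : Fin M, i = Sum.inl (e, k)) ∨
      (∃ u ∈ (estateOf H r o L b).Y, ∃ j : Fin T, i = Sum.inr (u, j)) := by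
  induction b with
  | nil => intro i hi; simp [CoinStrategy.used] at hi
  | cons a b ih =>
    intro i hi
    rw [CoinStrategy.used] at hi
    have hmono := estateOf_mono (H := H) (r := r) (o := o) (L := L) a b
    cases hq : enq H r o L (estateOf H r o L b) with
    | none =>
      have hnext : (hStrategy H r o L M T).next b = none := by rw [hStrategy_next, hq]; rfl
      rw [hnext] at hi
      rcases ih i hi with ⟨e, he, k, rfl⟩ | ⟨u, hu, j, rfl⟩
      · exact Or.inl ⟨e, hmono.2.1 he, k, rfl⟩
      · exact Or.inr ⟨u, hmono.2.2.2 hu, j, rfl⟩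
    | some q =>
      have hnext : (hStrategy H r o L M T).next b = some (hEncode M T q) := by rw [hStrategy_next, hq]; rfl
      rw [hnext] at hi
      simp only at hi
      rcases (@Finset.mem_union _ (Classical.decEq _) _ _ _).1 hi with hi | hi
      · -- the new coins
        have hst : estateOf H r o L (a :: b) = estep H r (estateOf H r o L b) q a := by
          rw [estateOf_cons, hq]
        cases q with
        | edge u v =>
          left
          obtain ⟨k, rfl⟩ := mem_edgeCoins.1 hi
          refine ⟨s(u, v), ?_, k, rfl⟩
          rw [hst]
          simp [estep]
        | bonus u =>
          right
          obtain ⟨j, rfl⟩ := mem_markCoins.1 hi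
          refine ⟨u, ?_, j, rfl⟩
          rw [hst]
          simp [estep]
      · rcases ih i hi with ⟨e, he, k, rfl⟩ | ⟨u, hu, j, rfl⟩
        · exact Or.inl ⟨e, hmono.2.1 he, k, rfl⟩
        · exact Or.inr ⟨u, hmono.2.2.2 hu, j, rfl⟩

/-- **Freshness of the `ℋ`-side strategy**: an edge is queried only while unqueried, a bonus only while
un-attempted, so every query reads fresh coins. [cite: MartineauSevero2019, §5 ("No vertex or edge will get explored more than once")] -/
theorem hStrategy_freshAlong (M T : ℕ) : (hStrategy H r o L M T).FreshAlong := by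
  intro b Qy _ hQ
  rw [hStrategy_next, Option.map_eq_some_iff] at hQ
  obtain ⟨q, hq, rfl⟩ := hQ
  rw [Finset.disjoint_left]
  intro i hi hused
  rcases used_hStrategy_subset b i hused with ⟨e, he, k, rfl⟩ | ⟨u, hu, j, rfl⟩
  · cases q with
    | edge u v =>
      obtain ⟨k', hk'⟩ := mem_edgeCoins.1 hi
      simp only [Sum.inl.injEq, Prod.mk.injEq] at hk'
      obtain ⟨rfl, -⟩ := hk'
      exact (enq_edge_spec hq).2.2.2 he
    | bonus u => obtain ⟨j, hj⟩ := mem_markCoins.1 hi; simp at hj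
  · cases q with
    | edge u' v => obtain ⟨k, hk⟩ := mem_edgeCoins.1 hi; simp at hk
    | bonus u' =>
      obtain ⟨j', hj'⟩ := mem_markCoins.1 hi
      simp only [Sum.inr.injEq, Prod.mk.injEq] at hj'
      obtain ⟨rfl, -⟩ := hj'
      exact (enq_bonus_spec hq).2.2.2.1 hu

/-! ### Runs: the potential and the halting bound -/

/-- One step of the run of the `ℋ`-side strategy, at the level of states. [folklore] -/
theorem estateOf_run_succ {M T : ℕ} (n : ℕ) (c : Set (HCoin W M T)) :
    estateOf H r o L ((hStrategy H r o L M T).run (n + 1) c) =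
      match enq H r o L (estateOf H r o L ((hStrategy H r o L M T).run n c)) with
      | none => estateOf H r o L ((hStrategy H r o L M T).run n c)
      | some q => estep H r (estateOf H r o L ((hStrategy H r o L M T).run n c)) q ((hEncode M T q).answer c) := by
  rw [CoinStrategy.run_succ]
  cases hq : enq H r o L (estateOf H r o L ((hStrategy H r o L M T).run n c)) with
  | none =>
    have : (hStrategy H r o L M T).next ((hStrategy H r o L M T).run n c) = none := by rw [hStrategy_next, hq]; rfl
    rw [this]
  | some q =>
    have : (hStrategy H r o L M T).next ((hStrategy H r o L M T).run n c) = some (hEncode M T q) := by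
      rw [hStrategy_next, hq]; rfl
    rw [this]
    simp only
    rw [estateOf_cons, hq]

/-- **The potential**: along a run, `|Q| + |Y|` equals the length of the transcript (every step queries a
new edge or attempts a new bonus). [cite: MartineauSevero2019, §5 (finitely many iterations)] -/
theorem potential_run {M T : ℕ} (n : ℕ) (c : Set (HCoin W M T)) :
    (estateOf H r o L ((hStrategy H r o L M T).run n c)).Q.card +
      (estateOf H r o L ((hStrategy H r o L M T).run n c)).Y.card = ((hStrategy H r o L M T).run n c).length := by
  induction n with
  | zero => simp [estateOf, EState.init]
  | succ n ih =>
    rw [CoinStrategy.run_succ]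
    cases hq : enq H r o L (estateOf H r o L ((hStrategy H r o L M T).run n c)) with
    | none =>
      have : (hStrategy H r o L M T).next ((hStrategy H r o L M T).run n c) = none := by rw [hStrategy_next, hq]; rfl
      rw [this]
      exact ih
    | some q =>
      have : (hStrategy H r o L M T).next ((hStrategy H r o L M T).run n c) = some (hEncode M T q) := by
        rw [hStrategy_next, hq]; rfl
      rw [this]
      simp only [List.length_cons]
      rw [estateOf_cons, hq]
      cases q with
      | edge u v =>
        have hsp := enq_edge_spec hq
        simp only [estep]
        rw [Finset.card_insert_of_notMem hsp.2.2.2]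
        omega
      | bonus u =>
        have hsp := (enq_bonus_spec hq).2
        simp only [estep]
        rw [Finset.card_insert_of_notMem hsp.2.2.1]
        omega

/-- The length of a run transcript is bounded by the size of the windows. [cite: MartineauSevero2019, §5] -/
theorem length_run_le {M T : ℕ} (n : ℕ) (c : Set (HCoin W M T)) :
    ((hStrategy H r o L M T).run n c).length ≤ (edgeWindow H r o L).card + (vertWindow H o L).card := by
  rw [← potential_run n c]
  obtain ⟨h1, -, h3⟩ := estateOf_window (H := H) (r := r) (o := o) (L := L) ((hStrategy H r o L M T).run n c)
  exact Nat.add_le_add (Finset.card_le_card h1) (Finset.card_le_card h3)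

/-- While the machine is live the transcript grows by one per step. [folklore] -/
theorem length_run_eq_of_live {M T : ℕ} {n : ℕ} {c : Set (HCoin W M T)}
    (h : enq H r o L (estateOf H r o L ((hStrategy H r o L M T).run n c)) ≠ none) :
    ((hStrategy H r o L M T).run n c).length = n := by
  induction n with
  | zero => rfl
  | succ n ih =>
    -- if the machine were halted at step `n` it would still be halted at step `n+1`
    by_cases hn : enq H r o L (estateOf H r o L ((hStrategy H r o L M T).run n c)) = none
    · exfalso
      refine h ?_
      have hrun : (hStrategy H r o L M T).run (n + 1) c = (hStrategy H r o L M T).run n c := by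
        rw [CoinStrategy.run_succ]
        have : (hStrategy H r o L M T).next ((hStrategy H r o L M T).run n c) = none := by rw [hStrategy_next, hn]; rfl
        rw [this]
      rw [hrun]
      exact hn
    · rw [CoinStrategy.run_succ]
      cases hq : enq H r o L (estateOf H r o L ((hStrategy H r o L M T).run n c)) with
      | none => exact absurd hq hn
      | some q =>
        have : (hStrategy H r o L M T).next ((hStrategy H r o L M T).run n c) = some (hEncode M T q) := by
          rw [hStrategy_next, hq]; rfl
        rw [this]
        simp only [List.length_cons]
        rw [ih hn]

/-- **Halting bound**: after `N ≥ |E-window| + |V-window| + 1` steps the machine has halted.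
[cite: MartineauSevero2019, §5 ("When this step is finished, which occurs after finitely … many iterations")] -/
theorem enq_estateOf_run_eq_none {M T : ℕ} {N : ℕ} (hN : (edgeWindow H r o L).card + (vertWindow H o L).card + 1 ≤ N)
    (c : Set (HCoin W M T)) : enq H r o L (estateOf H r o L ((hStrategy H r o L M T).run N c)) = none := by
  by_contra h
  have h1 := length_run_eq_of_live h
  have h2 := length_run_le (H := H) (r := r) (o := o) (L := L) N c
  omega

/-! ### Correctness of the run on `ℋ` -/

/-- **Run invariants** (answers are read off the decoded configuration): explored vertices lie in the
enhanced cluster; a queried edge that is open is recorded open; recorded-open edges have explored endpoints;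
an attempted marked vertex has its sphere explored.
[cite: MartineauSevero2019, §5 (Conditions at the end of each iteration; Step ∞)] -/
theorem run_invariant {M T : ℕ} (hH : H.Connected) (n : ℕ) (c : Set (HCoin W M T)) :
    let σ := estateOf H r o L ((hStrategy H r o L M T).run n c)
    (↑σ.A ⊆ enhCluster H r {o} (hOmega c) (hAlpha c)) ∧
    (∀ e ∈ σ.Q, e ∈ hOmega c → e ∈ σ.O) ∧
    (∀ e ∈ σ.O, e ∈ hOmega c ∧ ∀ v ∈ e, v ∈ σ.A) ∧
    (∀ u ∈ σ.Y, u ∈ hAlpha c → sphereFin H u (r + 1) ⊆ σ.A) := by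
  induction n with
  | zero =>
    simp only [CoinStrategy.run_zero, estateOf, EState.init, Finset.coe_singleton, Finset.notMem_empty,
      IsEmpty.forall_iff, implies_true, and_true, and_self]
    exact subset_enhCluster _ _ _ _ _
  | succ n ih =>
    obtain ⟨hA, hQ, hO, hY⟩ := ih
    rw [estateOf_run_succ]
    cases hq : enq H r o L (estateOf H r o L ((hStrategy H r o L M T).run n c)) with
    | none => exact ⟨hA, hQ, hO, hY⟩
    | some q =>
      simp only
      cases q with
      | edge u v =>
        have hsp := enq_edge_spec hq
        rw [answer_hEncode_edge]
        by_cases hopen : s(u, v) ∈ hOmega c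
        · simp only [hopen, decide_true, estep, if_true]
          refine ⟨?_, ?_, ?_, ?_⟩
          · rw [Finset.coe_insert]
            exact Set.insert_subset (mem_enhCluster_of_adj (hA hsp.1) hsp.2.1 hopen) hA
          · intro e he _
            rcases Finset.mem_insert.1 he with rfl | he
            · exact Finset.mem_insert_self _ _
            · by_cases hee : e = s(u, v)
              · rw [hee]; exact Finset.mem_insert_self _ _
              · exact Finset.mem_insert_of_mem (hQ e he (by assumption))
          · intro e he
            rcases Finset.mem_insert.1 he with rfl | he
            · refine ⟨hopen, fun w hw => ?_⟩
              rcases Sym2.mem_iff.1 hw with rfl | rfl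
              · exact Finset.mem_insert_of_mem hsp.1
              · exact Finset.mem_insert_self _ _
            · exact ⟨(hO e he).1, fun w hw => Finset.mem_insert_of_mem ((hO e he).2 w hw)⟩
          · intro u' hu' hα
            exact (hY u' hu' hα).trans (Finset.subset_insert _ _)
        · simp only [hopen, decide_false, estep, Bool.false_eq_true, if_false]
          refine ⟨hA, ?_, hO, hY⟩
          intro e he heo
          rcases Finset.mem_insert.1 he with rfl | he
          · exact absurd heo hopen
          · exact hQ e he heo
      | bonus u =>
        have hsp := (enq_bonus_spec hq).2
        rw [answer_hEncode_bonus]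
        by_cases hmark : u ∈ hAlpha c
        · simp only [hmark, decide_true, estep, if_true]
          refine ⟨?_, hQ, ?_, ?_⟩
          · rw [Finset.coe_union]
            refine Set.union_subset hA fun v hv => ?_
            have hv' := (mem_sphereFin_iff hH).1 hv
            refine mem_enhCluster_of_bonus (hA hsp.1) hmark (fun e he => ?_) hv'
            exact (hO e (hsp.2.2.2 (mem_edgesInBallFin.2 he))).1
          · intro e he
            exact ⟨(hO e he).1, fun w hw => Finset.mem_union_left _ ((hO e he).2 w hw)⟩
          · intro u' hu' hα
            rcases Finset.mem_insert.1 hu' with rfl | hu'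
            · exact Finset.subset_union_right
            · exact (hY u' hu' hα).trans Finset.subset_union_left
        · simp only [hmark, decide_false, estep, Bool.false_eq_true, if_false]
          refine ⟨hA, hQ, hO, ?_⟩
          intro u' hu' hα
          rcases Finset.mem_insert.1 hu' with rfl | hu'
          · exact absurd hα hmark
          · exact hY u' hu' hα

/-- At a halted state of a run, a fully open ball around an explored vertex of `B_L(o)`... more precisely:
if `u` is explored, every edge of `B_k(u)` is open and lies in the edge window, and no edge query is available,
then `B_k(u)` is explored and its edges are recorded open. [cite: MartineauSevero2019, §5 (Step 2K+2 happens after Step 2K+1 is finished)] -/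
theorem ball_explored_of_noEdgeAvail {M T : ℕ} (n : ℕ) (c : Set (HCoin W M T)) (hH : H.Connected)
    (hne : ¬ ∃ p : W × W, EdgeAvail H r o L (estateOf H r o L ((hStrategy H r o L M T).run n c)) p)
    {u : W} (hu : u ∈ (estateOf H r o L ((hStrategy H r o L M T).run n c)).A) {k : ℕ}
    (hopen : edgesInBall H u k ⊆ hOmega c) (hwin : edgesInBall H u k ⊆ ↑(edgeWindow H r o L)) :
    (∀ v ∈ graphBall H u k, v ∈ (estateOf H r o L ((hStrategy H r o L M T).run n c)).A) ∧
      ∀ e ∈ edgesInBall H u k, e ∈ (estateOf H r o L ((hStrategy H r o L M T).run n c)).O := by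
  obtain ⟨-, hQ, hO, -⟩ := run_invariant (H := H) (r := r) (o := o) (L := L) hH n c
  set σ := estateOf H r o L ((hStrategy H r o L M T).run n c) with hσ
  -- an open window edge at an explored vertex is recorded open (else it would be available)
  have key : ∀ a b : W, a ∈ σ.A → H.Adj a b → s(a, b) ∈ hOmega c → s(a, b) ∈ edgeWindow H r o L → s(a, b) ∈ σ.O := by
    intro a b ha hab ho hw
    by_cases hq : s(a, b) ∈ σ.Q
    · exact hQ _ hq ho
    · exact absurd ⟨(a, b), ha, hab, hw, hq⟩ hne
  have hballA : ∀ j, j ≤ k → ∀ v ∈ graphBall H u j, v ∈ σ.A := by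
    intro j
    induction j with
    | zero =>
      intro _ v hv
      rw [graphBall_zero, Set.mem_singleton_iff] at hv
      rw [hv]; exact hu
    | succ j ih =>
      intro hj v hv
      rcases (mem_graphBall_succ_iff' H u v j).1 hv with rfl | ⟨v', hv', hadj⟩
      · exact hu
      · have hv'A := ih (Nat.le_of_succ_le hj) v' hv'
        have hein : s(v', v) ∈ edgesInBall H u k :=
          ⟨hadj, graphBall_mono H u (Nat.le_of_succ_le hj) hv', graphBall_mono H u hj hv⟩
        have hvO := key v' v hv'A hadj (hopen hein) (hwin hein)
        exact (hO _ hvO).2 v (Sym2.mem_mk_right _ _)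
  refine ⟨hballA k le_rfl, fun e he => ?_⟩
  have he' := he
  obtain ⟨hadj, hmem⟩ := he
  induction e using Sym2.inductionOn with
  | hf a b => exact key a b (hballA k le_rfl a hmem.1) hadj (hopen he') (hwin he')

/-- **Correctness of the exploration on `ℋ`.** After the machine has halted (`N ≥ N₀`), the transcript event
"some explored vertex lies at distance `≥ L` from `o`" coincides with the event `𝓔_L` of the decoded
configuration `(ω, α) = (hOmega c, hAlpha c)`. [cite: MartineauSevero2019, §5 (Step ∞: "C_∞ … is the cluster of the origin of ((∨_k ω_{e,k})_e, α)")] -/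
theorem setOf_reaches_run_eq {M T : ℕ} (hH : H.Connected) {N : ℕ}
    (hN : (edgeWindow H r o L).card + (vertWindow H o L).card + 1 ≤ N) :
    {c : Set (HCoin W M T) | ∃ v ∈ (estateOf H r o L ((hStrategy H r o L M T).run N c)).A, L ≤ H.dist o v} =
      {c | ∃ v, v ∈ enhCluster H r {o} (hOmega c) (hAlpha c) ∧ L ≤ H.dist o v} := by
  ext c
  obtain ⟨hA, hQ, hO, hY⟩ := run_invariant (H := H) (r := r) (o := o) (L := L) hH N c
  have hhalt := enq_estateOf_run_eq_none (H := H) (r := r) (o := o) (L := L) (M := M) (T := T) hN c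
  set σ := estateOf H r o L ((hStrategy H r o L M T).run N c) with hσ
  rw [enq_eq_none_iff] at hhalt
  constructor
  · rintro ⟨v, hv, hLv⟩
    exact ⟨v, hA hv, hLv⟩
  · intro hfar
    -- closure principle for the halted explored set
    refine exists_far_of_closed (H := H) (r := r) (o := o) (L := L) (ω := hOmega c) (α := hAlpha c)
      (↑σ.A) (origin_mem_estateOf _) ?_ ?_ hfar
    · -- edge closure below distance `L`
      intro u w hu hud hadj he
      have hwin : s(u, w) ∈ edgeWindow H r o L := by
        rw [edgeWindow, mem_edgesInBallFin, mk_mem_edgesInBall_iff]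
        have h1 : H.dist o w ≤ H.dist o u + H.dist u w := hH.dist_triangle
        have h2 : H.dist u w = 1 := SimpleGraph.dist_eq_one_iff_adj.2 hadj
        exact ⟨hadj, mem_graphBall_of_dist_le hH (by omega), mem_graphBall_of_dist_le hH (by omega)⟩
      have hwO : s(u, w) ∈ σ.O := by
        by_cases hq : s(u, w) ∈ σ.Q
        · exact hQ _ hq he
        · exact absurd ⟨(u, w), hu, hadj, hwin, hq⟩ hhalt.1
      exact (hO _ hwO).2 w (Sym2.mem_mk_right _ _)
    · -- bonus closure below distance `L`
      intro u w hu hud hα hball hd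
      have hwin : edgesInBall H u r ⊆ ↑(edgeWindow H r o L) := by
        intro e he
        rw [Finset.mem_coe, edgeWindow, mem_edgesInBallFin]
        have := edgesInBall_subset_edgesInBall_of_dist_le hH (n := r) (m := L) hud.le he
        exact edgesInBall_mono H o (by omega) this
      obtain ⟨-, hOball⟩ := ball_explored_of_noEdgeAvail N c hH hhalt.1 hu hball hwin
      have huY : u ∈ σ.Y := by
        by_contra huY
        refine hhalt.2 ⟨u, hu, ?_, huY, fun e he => hOball e (mem_edgesInBallFin.1 he)⟩
        rw [vertWindow, mem_ballFin]
        exact mem_graphBall_of_dist_le hH hud.le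
      exact hY u huY hα ((mem_sphereFin_iff hH).2 hd)

end Machine

end Literature.Probability.Percolation
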